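import Summits.AtomisticToContinuum.Crystallization.Theorems.PhononStability.Negative.Mirror

/-!
# Route `HolmgrenBoyleLind`, item `FiniteRigidity` (stmt-AtomisticToContinuum-6078): the
Lennard-Jones force kernel, its Kelvin transform, and the far field of a finite signed source

Helper file.  The route's force summand `(V′(|x−y|)/|x−y|)·(x−y)` equals `K(x − y)` with the kernel
`K(v) = ((‖v‖²)⁻⁴ − (‖v‖²)⁻⁷) v` (`ljForce_eq_kernel`; `V′(r) = −r⁻¹³ + r⁻⁷`).  `K` is
real-analytic off `0` (`analyticAt_kernel`), blows up like `‖v‖⁻¹³` at `0`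
(`inv_norm_le_norm_kernel`), and under the Kelvin inversion `x = u/‖u‖²` each translate
`K(x − y)` becomes an explicit real-analytic function of `u` near `u = 0` (`kernel_kelvin`).
These are the ingredients of the far-field step of `HolmgrenBoyleLindFiniteRigidity.lean`.
All `[folklore]`.
-/

noncomputable section

namespace Summit.AtomisticToContinuum.Crystallization.Theorems.HolmgrenBoyleLind

open scoped BigOperators Topology InnerProductSpace
open Filter Set
open Literature.MathematicalPhysics.StatisticalMechanics

/-! ## The kernel -/

/-- The route's pair-force summand is the kernel `K(v) = ((‖v‖²)⁻⁴ − (‖v‖²)⁻⁷) v` at `v = x − y`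
(`V′(r)/r = r⁻⁸ − r⁻¹⁴`). [folklore] -/
theorem ljForce_eq_kernel {x y : EuclideanSpace ℝ (Fin 3)} (hxy : y ≠ x) :
    (deriv lennardJones (dist x y) / dist x y) • (x - y) =
      (((‖x - y‖ ^ 2) ^ 4)⁻¹ - ((‖x - y‖ ^ 2) ^ 7)⁻¹) • (x - y) := by
  have hd : 0 < dist x y := dist_pos.2 (Ne.symm hxy)
  rw [PhononStabilityNegative.deriv_lennardJones hd.ne', dist_eq_norm]
  rw [dist_eq_norm] at hd
  congr 1
  have hn : ‖x - y‖ ≠ 0 := hd.ne'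
  field_simp
  ring

variable {V : Type*} [NormedAddCommGroup V] [InnerProductSpace ℝ V]

/-- `v ↦ ‖v‖²` is real-analytic on a real inner product space. [folklore] -/
theorem analyticAt_norm_sq (u : V) : AnalyticAt ℝ (fun v : V => ‖v‖ ^ 2) u := by
  have h1 := (innerSL ℝ (E := V)).analyticAt_bilinear (u, u)
  have h2 : AnalyticAt ℝ (fun v : V => (v, v)) u := analyticAt_id.prod analyticAt_id
  refine (AnalyticAt.comp (g := fun x : V × V => innerSL ℝ x.1 x.2) (f := fun v : V => (v, v))
    (x := u) h1 h2).congr (Eventually.of_forall fun v => ?_)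
  simp only [Function.comp_apply, innerSL_apply_apply, real_inner_self_eq_norm_sq]

/-- `v ↦ ⟪v, y⟫` is real-analytic. [folklore] -/
theorem analyticAt_inner_const (y u : V) : AnalyticAt ℝ (fun v : V => ⟪v, y⟫_ℝ) u := by
  refine ((innerSL ℝ y).analyticAt u).congr (Eventually.of_forall fun v => ?_)
  simp only [innerSL_apply_apply]
  exact real_inner_comm _ _

/-- The kernel `K` is real-analytic away from `0`. [folklore] -/
theorem analyticAt_kernel {v₀ : EuclideanSpace ℝ (Fin 3)} (hv : v₀ ≠ 0) :
    AnalyticAt ℝ (fun v : EuclideanSpace ℝ (Fin 3) =>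
      (((‖v‖ ^ 2) ^ 4)⁻¹ - ((‖v‖ ^ 2) ^ 7)⁻¹) • v) v₀ := by
  have hs := analyticAt_norm_sq v₀
  have hne : ‖v₀‖ ^ 2 ≠ 0 := pow_ne_zero 2 (norm_ne_zero_iff.2 hv)
  exact (((hs.fun_pow 4).fun_inv (pow_ne_zero _ hne)).fun_sub
    ((hs.fun_pow 7).fun_inv (pow_ne_zero _ hne))).fun_smul analyticAt_id

/-- The translate `z ↦ K(z − y)` is real-analytic at every `z ≠ y`. [folklore] -/
theorem analyticAt_kernel_sub (y : EuclideanSpace ℝ (Fin 3)) {z₀ : EuclideanSpace ℝ (Fin 3)}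
    (hz : z₀ ≠ y) :
    AnalyticAt ℝ (fun z : EuclideanSpace ℝ (Fin 3) =>
      (((‖z - y‖ ^ 2) ^ 4)⁻¹ - ((‖z - y‖ ^ 2) ^ 7)⁻¹) • (z - y)) z₀ := by
  have h1 : AnalyticAt ℝ (fun z : EuclideanSpace ℝ (Fin 3) => z - y) z₀ :=
    analyticAt_id.fun_sub analyticAt_const
  exact AnalyticAt.comp
    (g := fun v : EuclideanSpace ℝ (Fin 3) => (((‖v‖ ^ 2) ^ 4)⁻¹ - ((‖v‖ ^ 2) ^ 7)⁻¹) • v)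
    (f := fun z : EuclideanSpace ℝ (Fin 3) => z - y) (x := z₀)
    (analyticAt_kernel (sub_ne_zero.2 hz)) h1

/-- Blow-up at the source: `‖v‖⁻¹ ≤ ‖K(v)‖` for `0 < ‖v‖ ≤ 1/2`. [folklore] -/
theorem inv_norm_le_norm_kernel {v : EuclideanSpace ℝ (Fin 3)} (hv0 : v ≠ 0) (hv : ‖v‖ ≤ 1 / 2) :
    ‖v‖⁻¹ ≤ ‖(((‖v‖ ^ 2) ^ 4)⁻¹ - ((‖v‖ ^ 2) ^ 7)⁻¹) • v‖ := by
  have ht : 0 < ‖v‖ := norm_pos_iff.2 hv0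
  rw [norm_smul, Real.norm_eq_abs]
  set t := ‖v‖ with htdef
  have ht2 : 0 < t ^ 2 := by positivity
  have hw : 4 ≤ (t ^ 2)⁻¹ := by
    rw [le_inv_comm₀ (by norm_num) ht2]
    nlinarith
  set w := (t ^ 2)⁻¹ with hwdef
  have h4 : ((t ^ 2) ^ 4)⁻¹ = w ^ 4 := by rw [hwdef, inv_pow]
  have h7 : ((t ^ 2) ^ 7)⁻¹ = w ^ 7 := by rw [hwdef, inv_pow]
  rw [h4, h7]
  have hw1 : 1 ≤ w := le_trans (by norm_num) hw
  have hdiff : w ^ 4 ≤ w ^ 7 := pow_le_pow_right₀ hw1 (by norm_num)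
  rw [abs_of_nonpos (sub_nonpos.2 hdiff), neg_sub]
  have hwt : t⁻¹ = w * t := by
    rw [hwdef]
    field_simp [ht.ne']
  rw [hwt]
  apply mul_le_mul_of_nonneg_right _ ht.le
  have h3 : 64 ≤ w ^ 3 := by
    calc (64 : ℝ) = 4 ^ 3 := by norm_num
      _ ≤ w ^ 3 := pow_le_pow_left₀ (by norm_num) hw 3
  have h14 : w ≤ w ^ 4 := by
    calc w = w ^ 1 := (pow_one w).symm
      _ ≤ w ^ 4 := pow_le_pow_right₀ hw1 (by norm_num)
  nlinarith [mul_nonneg (sub_nonneg.2 h3) (pow_nonneg (zero_le_one.trans hw1) 4)]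

/-! ## Kelvin inversion `x = u / ‖u‖²` -/

/-- `‖u/‖u‖²‖ = ‖u‖⁻¹`. [folklore] -/
theorem norm_kelvin {x : V} (hx : x ≠ 0) : ‖(‖x‖ ^ 2)⁻¹ • x‖ = ‖x‖⁻¹ := by
  have h : ‖x‖ ≠ 0 := norm_ne_zero_iff.2 hx
  rw [norm_smul, norm_inv, norm_pow, norm_norm]
  field_simp

/-- The Kelvin inversion has no zero away from `0`. [folklore] -/
theorem kelvin_ne_zero {x : V} (hx : x ≠ 0) : (‖x‖ ^ 2)⁻¹ • x ≠ 0 :=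
  smul_ne_zero (inv_ne_zero (pow_ne_zero 2 (norm_ne_zero_iff.2 hx))) hx

/-- The Kelvin inversion is an involution. [folklore] -/
theorem kelvin_kelvin {x : V} (hx : x ≠ 0) :
    (‖(‖x‖ ^ 2)⁻¹ • x‖ ^ 2)⁻¹ • ((‖x‖ ^ 2)⁻¹ • x) = x := by
  have h : ‖x‖ ^ 2 ≠ 0 := pow_ne_zero 2 (norm_ne_zero_iff.2 hx)
  rw [norm_kelvin hx, smul_smul, inv_pow, inv_inv, mul_inv_cancel₀ h, one_smul]

/-- The Kelvin inversion preserves directions. [folklore] -/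
theorem dir_kelvin {x : V} (hx : x ≠ 0) :
    ‖(‖x‖ ^ 2)⁻¹ • x‖⁻¹ • ((‖x‖ ^ 2)⁻¹ • x) = ‖x‖⁻¹ • x := by
  have h : ‖x‖ ≠ 0 := norm_ne_zero_iff.2 hx
  rw [norm_kelvin hx, smul_smul, inv_inv]
  congr 1
  field_simp

/-- **Kelvin transform of a translate of the kernel.** For `u ≠ 0`, with `x = u/‖u‖²` and
`q = 1 − 2⟪u, y⟫ + ‖y‖²‖u‖²` one has `‖x − y‖² = q/‖u‖²`, `x − y = (u − ‖u‖² y)/‖u‖²`, hence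
`K(x − y) = (‖u‖⁶ q⁻⁴ − ‖u‖¹² q⁻⁷)(u − ‖u‖² y)` — a real-analytic function of `u` near `0`.
[folklore] -/
theorem kernel_kelvin (u y : V) (hu : u ≠ 0) :
    (((‖(‖u‖ ^ 2)⁻¹ • u - y‖ ^ 2) ^ 4)⁻¹ - ((‖(‖u‖ ^ 2)⁻¹ • u - y‖ ^ 2) ^ 7)⁻¹) •
        ((‖u‖ ^ 2)⁻¹ • u - y) =
      ((‖u‖ ^ 2) ^ 3 * ((1 - 2 * ⟪u, y⟫_ℝ + ‖y‖ ^ 2 * ‖u‖ ^ 2) ^ 4)⁻¹ -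
          (‖u‖ ^ 2) ^ 6 * ((1 - 2 * ⟪u, y⟫_ℝ + ‖y‖ ^ 2 * ‖u‖ ^ 2) ^ 7)⁻¹) •
        (u - ‖u‖ ^ 2 • y) := by
  have h : ‖u‖ ≠ 0 := norm_ne_zero_iff.2 hu
  set s : ℝ := ‖u‖ ^ 2 with hs
  have hs0 : s ≠ 0 := pow_ne_zero 2 h
  set q : ℝ := 1 - 2 * ⟪u, y⟫_ℝ + ‖y‖ ^ 2 * s with hq
  have hxy : s⁻¹ • u - y = s⁻¹ • (u - s • y) := by
    rw [smul_sub, smul_smul, inv_mul_cancel₀ hs0, one_smul]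
  have hnorm : ‖s⁻¹ • u - y‖ ^ 2 = s⁻¹ * q := by
    rw [hxy, norm_smul, mul_pow, norm_inv, norm_sub_sq_real, real_inner_smul_right, norm_smul,
      mul_pow, Real.norm_of_nonneg (show (0 : ℝ) ≤ s by positivity), ← hs, hq]
    field_simp
  rw [hnorm, hxy, smul_smul]
  congr 1
  rw [mul_pow, mul_pow, mul_inv, mul_inv, inv_pow, inv_pow, inv_inv, inv_inv]
  have e4 : s ^ 4 * s⁻¹ = s ^ 3 := by field_simp
  have e7 : s ^ 7 * s⁻¹ = s ^ 6 := by field_simp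
  calc (s ^ 4 * (q ^ 4)⁻¹ - s ^ 7 * (q ^ 7)⁻¹) * s⁻¹
      = s ^ 4 * s⁻¹ * (q ^ 4)⁻¹ - s ^ 7 * s⁻¹ * (q ^ 7)⁻¹ := by ring
    _ = s ^ 3 * (q ^ 4)⁻¹ - s ^ 6 * (q ^ 7)⁻¹ := by rw [e4, e7]

/-- The Kelvin-transformed translate is real-analytic at `u = 0` (where `q = 1`). [folklore] -/
theorem analyticAt_kernel_kelvin (y : V) :
    AnalyticAt ℝ (fun u : V =>
      ((‖u‖ ^ 2) ^ 3 * ((1 - 2 * ⟪u, y⟫_ℝ + ‖y‖ ^ 2 * ‖u‖ ^ 2) ^ 4)⁻¹ -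
          (‖u‖ ^ 2) ^ 6 * ((1 - 2 * ⟪u, y⟫_ℝ + ‖y‖ ^ 2 * ‖u‖ ^ 2) ^ 7)⁻¹) •
        (u - ‖u‖ ^ 2 • y)) 0 := by
  have hs := analyticAt_norm_sq (0 : V)
  have hi := analyticAt_inner_const y (0 : V)
  have hq : AnalyticAt ℝ (fun u : V => 1 - 2 * ⟪u, y⟫_ℝ + ‖y‖ ^ 2 * ‖u‖ ^ 2) 0 :=
    (analyticAt_const.fun_sub (analyticAt_const.fun_mul hi)).fun_add (analyticAt_const.fun_mul hs)
  have hq0 : (1 - 2 * ⟪(0 : V), y⟫_ℝ + ‖y‖ ^ 2 * ‖(0 : V)‖ ^ 2) ≠ 0 := by simp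
  have hscal : AnalyticAt ℝ (fun u : V =>
      (‖u‖ ^ 2) ^ 3 * ((1 - 2 * ⟪u, y⟫_ℝ + ‖y‖ ^ 2 * ‖u‖ ^ 2) ^ 4)⁻¹ -
        (‖u‖ ^ 2) ^ 6 * ((1 - 2 * ⟪u, y⟫_ℝ + ‖y‖ ^ 2 * ‖u‖ ^ 2) ^ 7)⁻¹) 0 :=
    ((hs.fun_pow 3).fun_mul ((hq.fun_pow 4).fun_inv (pow_ne_zero _ hq0))).fun_sub
      ((hs.fun_pow 6).fun_mul ((hq.fun_pow 7).fun_inv (pow_ne_zero _ hq0)))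
  exact hscal.fun_smul (analyticAt_id.fun_sub (hs.fun_smul analyticAt_const))

end Summit.AtomisticToContinuum.Crystallization.Theorems.HolmgrenBoyleLind

end
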